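import Literature.AnabelianGeometry.EtaleTheta.SettingModelChiCoverings
import Literature.AnabelianGeometry.EtaleTheta.SettingModelThetaCentreZHat
import HarnessLib

/-!
# The χ-twisted root model of [EtTh] §1 (R78 (B)) — conjugation acts on the theta centre through `χ`

Mochizuki, *The étale theta function …*, Publ. RIMS **45** (2009) [EtTh], §1, PRIMS PDF p. 12
[cite: MochizukiEtTh2009, §1 p.12]: "`(Ẑ(1) ≅) Δ_Θ`" — the Galois group acts on `Δ_Θ` through the cyclotomic
character. Layer L2 of the abc-iut cell (seat abc-iut-L6-d6 gen 4; abc-iut-L2-lead gen 3 RULINGS #13 R100, file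
F1c-model/part 1 of the R78 cluster), PROOF-ONLY, over abc-iut-L2-t1's `SettingModelChiCoverings.lean` (the action
`actχ = twistGfp ∘ χ : G_{ℚ_p} → Aut Γ`, `Γ = F̂₂ ×_Ẑ ℤ`), abc-iut-w5-d024's `SettingModelChiTwist.lean` and this seat's
`SettingModelThetaCentreZHat.lean`. CARRIER-LEVEL statements on Mathlib's semidirect product
`Γ ⋊[actχ p] G_{ℚ_p}` (= the carrier of `Π^tp_X` of the twisted model, files F4/F5b), independent of its topology:

* `right_conj_inl`, `gfpFst_left_conj_inl` — conjugating `inl γ` by `g = (g_Γ, σ)` gives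
  `inl (g_Γ · θ_{χσ}(γ) · g_Γ⁻¹)`;
* **`hHat_gfpFst_left_conj_inl_of_mem_closure`** — for `γ` in the derived closure `[F̂₂,F̂₂]⁻`
  (`x = y = 0` at every level), `ĥ_N` of the conjugate is `(0, 0, χ_N(σ) · z_N(γ))`: **conjugation by any
  element of `Π^tp_X` over `σ` acts on the `Ẑ`-coordinate of the theta centre by the cyclotomic character
  `χ_N(σ)`** — i.e. `Δ_Θ ≅ Ẑ(χ) = Ẑ(1)` at the twisted model (the geometric part acts trivially: the centre
  is central in the class-two quotient);
* `conj_inl_mul_inv_mem_closure₃` — the conjugate of `inl(c^t)` by `g` over `σ` is `≡ inl(c^{χ(σ) t})` modulo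
  `inl([[F̂₂,F̂₂],F̂₂]⁻)`, with `c^· : Ẑ → F̂₂` any continuous homomorphism with `ι 1 ↦ η⁅a,b⁆`
  (`SettingModelThetaCentreZHat.exists_cPow`);
* `inlCPow_mem_Gfp`-type bookkeeping: `(c^t, 0) ∈ Γ` (`ê(c^t) = 1`).

SEMI-SYNTHETIC MODEL (not the tempered `π₁` of a curve; «split-Tate» at stage 1: the deck direction `a` is fixed by
the twist); consistency evidence only; nothing of [EtTh] is asserted; no side is taken on [IUTchIII] Cor. 3.12. No
definitions, no instances, no Prop facts.
-/

noncomputable section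

namespace Literature.AnabelianGeometry.EtaleTheta.SettingModel

open Literature.AnabelianGeometry.SemiGraphs
open Function
open scoped commutatorElement

variable (p : ℕ) [Fact p.Prime]

/-! ### Conjugation of `inl γ` in `Γ ⋊_χ G_{ℚ_p}` -/

/-- The arithmetic component of a conjugate of `inl γ` is trivial. [cite: MochizukiEtTh2009, §1 p.12] -/
theorem right_conj_inl (g : Gfp ⋊[actχ p] GQp p) (γ : Gfp) :
    (g * SemidirectProduct.inl γ * g⁻¹).right = 1 := by
  simp [SemidirectProduct.mul_right, SemidirectProduct.inv_right]

/-- The `Γ`-component of `g · inl γ · g⁻¹` is `g_Γ · θ_{χ(σ)}(γ) · g_Γ⁻¹` (`g = (g_Γ, σ)`).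
[cite: MochizukiEtTh2009, §1 p.12] -/
theorem left_conj_inl (g : Gfp ⋊[actχ p] GQp p) (γ : Gfp) :
    (g * SemidirectProduct.inl γ * g⁻¹).left = g.left * actχ p g.right γ * g.left⁻¹ := by
  simp only [SemidirectProduct.mul_left, SemidirectProduct.mul_right, SemidirectProduct.inv_left,
    SemidirectProduct.left_inl, SemidirectProduct.right_inl, mul_one, map_inv, MulAut.apply_inv_self]

/-- The same on `F̂₂`-components: `pr₁((g·inl γ·g⁻¹)_Γ) = pr₁(g_Γ) · θ_{χ(σ)}(pr₁ γ) · pr₁(g_Γ)⁻¹`.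
[cite: MochizukiEtTh2009, §1 p.12] -/
theorem gfpFst_left_conj_inl (g : Gfp ⋊[actχ p] GQp p) (γ : Gfp) :
    gfpFst (g * SemidirectProduct.inl γ * g⁻¹).left =
      gfpFst g.left * twist (chi p g.right) (gfpFst γ) * (gfpFst g.left)⁻¹ := by
  rw [left_conj_inl, map_mul, map_mul, map_inv, actχ_apply, gfpFst_twistGfp]

/-- An element of the `z`-axis of `Heis R` is central. [cite: MochizukiEtTh2009, §1 p.12] -/
private theorem Heis.conj_eq_of_x_eq_zero_of_y_eq_zero {R : Type*} [CommRing R] (h d : Heis R) (hx : d.x = 0)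
    (hy : d.y = 0) : h * d * h⁻¹ = d := by
  have hc := Heis.zAxis_le_center (R := R) (show d ∈ Heis.zAxis from ⟨hx, hy⟩)
  rw [Subgroup.mem_center_iff] at hc
  rw [hc h, mul_inv_cancel_right]

/-- **Conjugation acts on the theta centre through `χ`.** For `γ ∈ Γ` whose `F̂₂`-component lies in the derived
closure `[F̂₂,F̂₂]⁻` and any `g = (g_Γ, σ) ∈ Γ ⋊_χ G_{ℚ_p}`:
`ĥ_N(g·γ·g⁻¹) = (0, 0, χ_N(σ) · z_N(γ))` — the geometric part acts trivially (the centre is central at every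
level), the Galois part by the level-`N` cyclotomic character. [cite: MochizukiEtTh2009, §1 p.12] -/
theorem hHat_gfpFst_left_conj_inl_of_mem_closure (g : Gfp ⋊[actχ p] GQp p) {γ : Gfp}
    (hγ : gfpFst γ ∈ (⁅(⊤ : Subgroup F₂hatT), (⊤ : Subgroup F₂hatT)⁆).topologicalClosure) (N : ℕ+) :
    hHat N (gfpFst (g * SemidirectProduct.inl γ * g⁻¹).left) =
      ⟨0, 0, ZHatLevel.levelChar N (chi p g.right) * (hHat N (gfpFst γ)).z⟩ := by
  obtain ⟨hx, hy⟩ := (mem_closure_commutator₂_iff_forall_hHat (gfpFst γ)).mp hγ N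
  have hD : hHat N (twist (chi p g.right) (gfpFst γ)) =
      ⟨0, 0, ZHatLevel.levelChar N (chi p g.right) * (hHat N (gfpFst γ)).z⟩ := by
    rw [hHat_twist]
    ext <;> simp [hx, hy]
  rw [gfpFst_left_conj_inl, map_mul, map_mul, map_inv, hD]
  exact Heis.conj_eq_of_x_eq_zero_of_y_eq_zero _ _ rfl rfl

/-- The conjugate of a derived-closure element stays in the derived closure (on `F̂₂`-components).
[cite: MochizukiEtTh2009, §1 p.12] -/
theorem gfpFst_left_conj_inl_mem_closure (g : Gfp ⋊[actχ p] GQp p) {γ : Gfp}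
    (hγ : gfpFst γ ∈ (⁅(⊤ : Subgroup F₂hatT), (⊤ : Subgroup F₂hatT)⁆).topologicalClosure) :
    gfpFst (g * SemidirectProduct.inl γ * g⁻¹).left ∈
      (⁅(⊤ : Subgroup F₂hatT), (⊤ : Subgroup F₂hatT)⁆).topologicalClosure := by
  rw [mem_closure_commutator₂_iff_forall_hHat]
  intro N
  rw [hHat_gfpFst_left_conj_inl_of_mem_closure p g hγ N]
  exact ⟨rfl, rfl⟩

/-- The `z`-coordinate form: `z_N(g·γ·g⁻¹) = χ_N(σ) · z_N(γ)`. [cite: MochizukiEtTh2009, §1 p.12] -/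
theorem hHat_z_conj_inl_of_mem_closure (g : Gfp ⋊[actχ p] GQp p) {γ : Gfp}
    (hγ : gfpFst γ ∈ (⁅(⊤ : Subgroup F₂hatT), (⊤ : Subgroup F₂hatT)⁆).topologicalClosure) (N : ℕ+) :
    (hHat N (gfpFst (g * SemidirectProduct.inl γ * g⁻¹).left)).z =
      ZHatLevel.levelChar N (chi p g.right) * (hHat N (gfpFst γ)).z := by
  rw [hHat_gfpFst_left_conj_inl_of_mem_closure p g hγ N]

/-! ### The `Ẑ`-coordinate `c^t` inside `Γ` and its conjugates -/

/-- `(c^t, 0) ∈ Γ = F̂₂ ×_Ẑ ℤ` (`ê(c^t) = 1 = ι 0`) for any `c^·` with `ι 1 ↦ η⁅a,b⁆`. [cite: MochizukiEtTh2009, §1 p.12] -/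
theorem cPow_mk_mem_Gfp (f : ZH →ₜ* F₂hatT)
    (hf : f (iotaZ (Multiplicative.ofAdd 1)) = eta ⁅FreeGroup.of (0 : Fin 2), FreeGroup.of 1⁆) (t : ZH) :
    ((f t, (1 : Multiplicative ℤ)) : F₂hatT × Multiplicative ℤ) ∈ Gfp := by
  rw [mem_Gfp, eHat_apply_of_cPowSpec f hf, map_one]

/-- **The conjugate of `inl(c^t)` over `σ` is `≡ inl(c^{χ(σ)·t})` modulo `inl([[F̂₂,F̂₂],F̂₂]⁻)`** (on
`F̂₂`-components): the `Ẑ`-coordinate of the theta centre is multiplied by `χ(σ)`.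
[cite: MochizukiEtTh2009, §1 p.12] -/
theorem conj_inl_cPow_mul_inv_mem_closure₃ (f : ZH →ₜ* F₂hatT)
    (hf : f (iotaZ (Multiplicative.ofAdd 1)) = eta ⁅FreeGroup.of (0 : Fin 2), FreeGroup.of 1⁆)
    (g : Gfp ⋊[actχ p] GQp p) (t : ZH) :
    gfpFst (g * SemidirectProduct.inl (⟨(f t, 1), cPow_mk_mem_Gfp f hf t⟩ : Gfp) * g⁻¹).left *
        (f (chi p g.right t))⁻¹ ∈
      (⁅⁅(⊤ : Subgroup F₂hatT), (⊤ : Subgroup F₂hatT)⁆, (⊤ : Subgroup F₂hatT)⁆).topologicalClosure := by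
  have hγ : gfpFst (⟨(f t, 1), cPow_mk_mem_Gfp f hf t⟩ : Gfp) ∈
      (⁅(⊤ : Subgroup F₂hatT), (⊤ : Subgroup F₂hatT)⁆).topologicalClosure :=
    apply_mem_closure_commutator_of_cPowSpec f hf t
  rw [mem_closure_commutator₃_iff_forall_hHat]
  intro N
  rw [map_mul, map_inv, hHat_gfpFst_left_conj_inl_of_mem_closure p g hγ N, hHat_apply_of_cPowSpec f hf,
    modN_eq_level, ZHatLevel.toAdd_level_aut]
  have : (hHat N (gfpFst (⟨(f t, 1), cPow_mk_mem_Gfp f hf t⟩ : Gfp))).z = Multiplicative.toAdd (ZHatLevel.level N t) := by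
    show (hHat N (f t)).z = _
    rw [hHat_apply_of_cPowSpec f hf, modN_eq_level]
  rw [this]
  ext <;> simp

/-- Unconjugated form: distinct coordinates give elements that are inequivalent modulo `[[F̂₂,F̂₂],F̂₂]⁻` — the
map `t ↦ inl(c^t)` is injective modulo the theta kernel (restatement of `cPow_coordinate_unique` inside `Γ`).
[cite: MochizukiEtTh2009, §1 p.12] -/
theorem cPow_gfp_coordinate_unique (f : ZH →ₜ* F₂hatT)
    (hf : f (iotaZ (Multiplicative.ofAdd 1)) = eta ⁅FreeGroup.of (0 : Fin 2), FreeGroup.of 1⁆) {t t' : ZH}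
    (h : gfpFst (⟨(f t, 1), cPow_mk_mem_Gfp f hf t⟩ : Gfp) * (gfpFst (⟨(f t', 1), cPow_mk_mem_Gfp f hf t'⟩ : Gfp))⁻¹ ∈
      (⁅⁅(⊤ : Subgroup F₂hatT), (⊤ : Subgroup F₂hatT)⁆, (⊤ : Subgroup F₂hatT)⁆).topologicalClosure) :
    t = t' := by
  have h' : f (t * t'⁻¹) ∈
      (⁅⁅(⊤ : Subgroup F₂hatT), (⊤ : Subgroup F₂hatT)⁆, (⊤ : Subgroup F₂hatT)⁆).topologicalClosure := by
    rw [map_mul, map_inv]; exact h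
  have := eq_one_of_cPow_mem_closure₃ f hf h'
  rwa [mul_inv_eq_one] at this

end Literature.AnabelianGeometry.EtaleTheta.SettingModel

end

-- (olean re-land 2026-08-26T08:15Z: comment-only touch so the farm rebuilds this module; declarations byte-identical)
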